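import Literature.Claims.NS.Liu2025
import Literature.Barriers.NavierStokesRegularity.SupNormCalderonZygmundWitnesses

/-!
# C09 `Liu2025` — ADDENDUM: the implicit Hodge sup-norm glue of p.29 (l.8–9) is kernel-false

Second located failure, DOWNSTREAM of the locator of record `Thm43NullSpaceV0`
(`Theorems/SoloRefuteLiu2025.lean`; MAP #10, token unchanged).  The skeleton's glue Step
`Literature.Claims.NS.Liu2025.HodgeSupBound` ("`‖ϕ₁‖_C + ‖ϕ₂‖_C ≤ C₀‖ϕ‖_C`, universal `C₀`", needed by
"Combining (4.19), (4.22)–(4.57), (4.59), (4.65), we get the desired result (4.16)", p.29 l.8–9) asserts that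
the Leray/Hodge projection is bounded on `L^∞`; it is an order-zero Calderón–Zygmund operator and the endpoint
bound fails — barrier witness family `Literature.Barriers.NavierStokesRegularity.SupNormCZ.exists_hodge_supNorm_witness`
(`Literature/Barriers/NavierStokesRegularity/SupNormCalderonZygmundWitnesses.lean`: lacunary family
`∑ 16^{-k}(χ·x₀x₁)(4^k·)`, Hodge triple `(Δu)e₁ = curl((∂₂u)e₀ − (∂₀u)e₂) + ∇∂₁u`, `sup‖φ‖ ≤ M` for all `N`
while `‖φ₁(0)‖, ‖φ₂(0)‖ ≥ N`).  Here only the instantiation: the witnesses are `C_c^∞` (so Schwartz, with the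
rapid decay supplied by the barrier file) and compactly supported pieces vanish at infinity, so the skeleton's
`IsSchwartzField` / `IsHodgePair` hypotheses are met; `K := C₀·M + 1` at `x = 0` is the contradiction.

Verdict vocabulary (cell): first failing step of record stays `Thm43NullSpaceV0` (class: false lemma); this
file records a second, independent false lemma downstream.  Refuter: ns-claims-refuter-5 g3; filed under
convention (b) by a salvage prover.
WHAT THIS IS NOT: not a claim about NS regularity or blow-up; not a claim about any author beyond the typed
locator.
-/

-- The summit's canonical theorem namespace repeats the summit name (single-conjunct summit).
set_option linter.dupNamespace false

noncomputable section

open scoped ContDiff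
open Literature.Analysis.FluidPDE Literature.Analysis.FunctionSpaces
open Literature.Claims.NS.Liu2025

namespace Summit.NavierStokesRegularity.NavierStokesRegularity.Theorems.Liu2025

/-- A compactly supported smooth decomposition `φ = φ₁ + φ₂`, `div φ₁ = 0`, `curl φ₂ = 0` is a Hodge pair in
the skeleton's sense ((4.21): both pieces `C^∞ ∩ C₀`). [cite: LiuGenqian2025NSLame, (4.21) p.24] -/
theorem isHodgePair_of_hasCompactSupport {φ φ₁ φ₂ : E3 → E3} (h₁ : ContDiff ℝ ∞ φ₁)
    (hc₁ : HasCompactSupport φ₁) (h₂ : ContDiff ℝ ∞ φ₂) (hc₂ : HasCompactSupport φ₂)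
    (hsum : ∀ x, φ x = φ₁ x + φ₂ x) (hdiv : VectorCalculus.IsDivFree φ₁) (hcurl : ∀ x, curl φ₂ x = 0) :
    IsHodgePair φ φ₁ φ₂ :=
  ⟨h₁, h₂, hc₁.is_zero_at_infty, hc₂.is_zero_at_infty, hsum, hdiv, hcurl⟩

/-- **The glue Step `HodgeSupBound` (p.29 l.8–9, implicit) is false**: a universal `C₀` with
`‖ϕ₁‖_C, ‖ϕ₂‖_C ≤ C₀‖ϕ‖_C` on the Hodge pairs of Schwartz fields bounds the Hodge components of every
`C_c^∞` triple of the barrier family `SupNormCZ.exists_hodge_supNorm_witness` by `C₀·M`, while the family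
reaches `‖φ₁(0)‖ ≥ C₀·M + 1`.
[cite: LiuGenqian2025NSLame, proof of Thm 4.3 p.29 l.8–9 (implicit)]
[cite: LemarieRieusset2016, Ch. 6 Def. 6.4 and Prop. 6.2] -/
theorem not_HodgeSupBound : ¬ HodgeSupBound := by
  rintro ⟨C₀, hC₀⟩
  obtain ⟨M, -, hK⟩ := Literature.Barriers.NavierStokesRegularity.SupNormCZ.exists_hodge_supNorm_witness
  obtain ⟨φ, φ₁, φ₂, hφ, h₁, h₂, -, hc₁, hc₂, hdφ, -, -, hsum, hdiv, hcurl, hbd, hK₁, -⟩ := hK (C₀ * M + 1)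
  have h := (hC₀ φ φ₁ φ₂ ⟨hφ, hdφ⟩ (isHodgePair_of_hasCompactSupport h₁ hc₁ h₂ hc₂ hsum hdiv hcurl) M hbd 0).1
  linarith

/-! The headline's type is literally the negation of the skeleton's glue decl. -/
example : ¬ Literature.Claims.NS.Liu2025.HodgeSupBound := not_HodgeSupBound

end Summit.NavierStokesRegularity.NavierStokesRegularity.Theorems.Liu2025

end
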